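import Literature.Probability.Percolation.ArmSeparationExtSpoke
import HarnessLib

/-!
# A tube crossed in a rotated frame meets a crossed tube of the original frame

Topic: Probability / Percolation; family `crit-perc`. A toolkit brick of the GENERIC landing
layer of Nolin's arm-separation theorem (Nolin 2008, Thm. 11, §4.3 Prop. 12 and §4.4
[arXiv 0711.4948: Prop. 11, Thm. 10, p. 12, Fig. 6]), towards
`Literature.Probability.Percolation.Nolin2008_prop17_quasiMult` (`FiveArmExponentFacts.lean`).

The junction step of `trapArm_to_entry` (`ArmSeparationExtSpoke.lean`), extracted for reuse:
a horizontal tube `Sp` crossed by the configuration read in the frame `i` (`rotConfig i ω`) and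
a tube `E` crossed by `ω`, in the position `SpokeMeetsRot i Sp E` (the tube `E` lies across the
far part of `ρ^i(Sp)` like a plus sign), have crossings that MEET: the start of the crossing of
`E` is joined to `ρ^i` of the far end of the crossing of `Sp` by an open path of
`ρ^i(Sp.box) ∪ E.box` (`rotTube_meets_crossing`). Used twice by the staircase corridors: the
spoke of an exit entering the common ring system, and the transfer tube of an exit leaving it
towards its own landing frame.

## References

* P. Nolin, *Near-critical percolation in two dimensions*, Electron. J. Probab. 13 (2008), §4.3
  Prop. 12 (proof), §4.4 (arXiv 0711.4948: Prop. 11; proof of Thm. 10, p. 12). [Nolin2008]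
-/

noncomputable section

open Set

namespace Literature.Probability.Percolation

open LatticeModels Tube

/-- **A tube crossed in the frame `i` meets a crossed tube of the original frame.** `Sp` a
horizontal tube with `rotConfig i ω ∈ Sp.event` witnessed by the crossing `x' → y'`, `E` crossed
by `ω` from `xE` to `yE`, and `SpokeMeetsRot i Sp E` (`i < 6`): then `xE` is joined to `ρ^i y'`
(and to `ρ^i x'`) by an open path inside `ρ^i(Sp.box) ∪ E.box`. [cite: Nolin2008, §4.3 Prop. 12 (proof) and §4.4 (arXiv 0711.4948: Prop. 11, Thm. 10)] -/
theorem rotTube_meets_crossing {i : ℕ} (hi : i < 6) {ω : SiteConfig (Site 2)} {Sp E : Tube} (hSph : Sp.horiz = true)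
    {x' y' : Site 2} (hs : Sp.IsCrossing (rotConfig i ω) x' y') {xE yE : Site 2} (hE : E.IsCrossing ω xE yE)
    (hJ : SpokeMeetsRot i Sp E) :
    PathIn triGraph ((triRotIsoPow i '' Sp.box ∪ E.box) ∩ ω) (triRotIsoPow i y') xE ∧
      PathIn triGraph ((triRotIsoPow i '' Sp.box ∪ E.box) ∩ ω) (triRotIsoPow i x') xE := by
  -- the crossing of `Sp` in the frame
  have hs' : x' 0 = Sp.a ∧ y' 0 = Sp.a + Sp.w := by
    have := hs.1; rw [hSph] at this; exact this
  have PH := hs.2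
  obtain ⟨SH, hSH, PH, TH⟩ := PH.exists_support
  have hSHb : ∀ v ∈ SH, Sp.a ≤ v 0 ∧ v 0 ≤ Sp.a + Sp.w ∧ Sp.b ≤ v 1 ∧ v 1 ≤ Sp.b + Sp.h := fun v hv =>
    (Tube.mem_box Sp).1 (hSH hv).1
  -- read in the original frame
  have PSphys := pathIn_of_rotConfig_open i (PH.mono hSH)
  obtain ⟨S, hS, PS, TS⟩ := PSphys.exists_support
  have hSω : S ⊆ ω := fun v hv => (hS hv).2
  have physS : ∀ v ∈ S, ∃ q ∈ Sp.box, triRotIsoPow i q = v := fun v hv => by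
    obtain ⟨⟨q, hq, hqv⟩, -⟩ := hS hv; exact ⟨q, hq, hqv⟩
  have star : ∀ p ∈ S, ∀ q ∈ S, PathIn triGraph S p q := fun p hp q hq => (TS p hp).symm.trans (TS q hq)
  -- the crossing of `E`
  obtain ⟨SE, hSE, PE, TE⟩ := hE.2.exists_support
  have hEbox : ∀ z ∈ SE, E.a ≤ z 0 ∧ z 0 ≤ E.a + E.w ∧ E.b ≤ z 1 ∧ z 1 ≤ E.b + E.h := fun z hz =>
    (Tube.mem_box E).1 (hSE hz).1
  have hE1 := hE.1
  have hy'b : Sp.a ≤ y' 0 ∧ y' 0 ≤ Sp.a + Sp.w ∧ Sp.b ≤ y' 1 ∧ y' 1 ≤ Sp.b + Sp.h := hSHb y' PH.right_mem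
  have hx'b : Sp.a ≤ x' 0 ∧ x' 0 ≤ Sp.a + Sp.w ∧ Sp.b ≤ x' 1 ∧ x' 1 ≤ Sp.b + Sp.h := hSHb x' PH.left_mem
  have meet : ∃ z, z ∈ S ∧ z ∈ SE := by
    interval_cases i
    · -- frame 0: the spoke is the horizontal tube itself; `E` vertical across its far part
      obtain ⟨hEh, h1, h2, h3, h4⟩ := hJ
      rw [hEh] at hE1
      obtain ⟨hxE, hyE⟩ : xE 1 = E.b ∧ yE 1 = E.b + E.h := hE1
      obtain ⟨fx0, -⟩ := rot_apply_formula x'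
      obtain ⟨fy0, -⟩ := rot_apply_formula y'
      refine exists_mem_of_cross (L := E.a) (R := E.a + E.w) (B := E.b) (T := E.b + E.h) (by omega) (by omega)
        PS (by rw [fx0]; omega) (by rw [fy0]; omega) (fun z hz _ _ => ?_) PE (by omega) (by omega)
        (fun z hz _ _ => ⟨(hEbox z hz).1, (hEbox z hz).2.1⟩)
      obtain ⟨q, hq, rfl⟩ := physS z hz
      obtain ⟨g0, g1, -⟩ := rot_apply_formula q
      rw [Tube.mem_box] at hq; rw [g0, g1] at *; constructor <;> omega
    · -- frame 1 (`ρ`): the strip `x₀ ∈ [-(b+h), -b]`, `x₀ + x₁ ∈ [a, a+w]`; `E` horizontal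
      obtain ⟨hEh, h1, h2, h3, h4⟩ := hJ
      rw [hEh] at hE1
      obtain ⟨hxE, hyE⟩ : xE 0 = E.a ∧ yE 0 = E.a + E.w := hE1
      obtain ⟨-, -, fx0, fx1, -⟩ := rot_apply_formula x'
      obtain ⟨-, -, fy0, fy1, -⟩ := rot_apply_formula y'
      obtain ⟨z, hzE, hzS⟩ := exists_mem_of_cross (L := -(Sp.b + Sp.h)) (R := -Sp.b) (B := E.b) (T := E.b + E.h)
        (by omega) (by omega) PE (by omega) (by omega) (fun z hz _ _ => ⟨(hEbox z hz).2.2.1, (hEbox z hz).2.2.2⟩)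
        PS (by rw [fx1]; omega) (by rw [fy1]; omega) (fun z hz _ _ => by
          obtain ⟨q, hq, rfl⟩ := physS z hz
          obtain ⟨-, -, g0, g1, -⟩ := rot_apply_formula q
          rw [Tube.mem_box] at hq; rw [g0]; constructor <;> omega)
      exact ⟨z, hzS, hzE⟩
    · -- frame 2 (`ρ²`): the strip `x₁ ∈ [a, a+w]`, `x₀ + x₁ ∈ [-(b+h), -b]`; `E` horizontal
      obtain ⟨hEh, h1, h2, h3, h4⟩ := hJ
      rw [hEh] at hE1
      obtain ⟨hxE, hyE⟩ : xE 0 = E.a ∧ yE 0 = E.a + E.w := hE1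
      obtain ⟨-, -, -, -, fx0, fx1, -⟩ := rot_apply_formula x'
      obtain ⟨-, -, -, -, fy0, fy1, -⟩ := rot_apply_formula y'
      obtain ⟨z, hzE, hzS⟩ := exists_mem_of_cross (L := E.a) (R := E.a + E.w) (B := E.b) (T := E.b + E.h)
        (by omega) (by omega) PE (by omega) (by omega) (fun z hz _ _ => ⟨(hEbox z hz).2.2.1, (hEbox z hz).2.2.2⟩)
        PS (by rw [fx1]; omega) (by rw [fy1]; omega) (fun z hz hzlo hzhi => by
          obtain ⟨q, hq, rfl⟩ := physS z hz
          obtain ⟨-, -, -, -, g0, g1, -⟩ := rot_apply_formula q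
          rw [Tube.mem_box] at hq; rw [g0]; rw [g1] at hzlo hzhi; constructor <;> omega)
      exact ⟨z, hzS, hzE⟩
    · -- frame 3 (`-id`): the reflected horizontal tube; `E` vertical
      obtain ⟨hEh, h1, h2, h3, h4⟩ := hJ
      rw [hEh] at hE1
      obtain ⟨hxE, hyE⟩ : xE 1 = E.b ∧ yE 1 = E.b + E.h := hE1
      obtain ⟨-, -, -, -, -, -, fx0, fx1, -⟩ := rot_apply_formula x'
      obtain ⟨-, -, -, -, -, -, fy0, fy1, -⟩ := rot_apply_formula y'
      refine exists_mem_of_cross (L := E.a) (R := E.a + E.w) (B := E.b) (T := E.b + E.h) (by omega) (by omega)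
        PS.symm (by rw [fy0]; omega) (by rw [fx0]; omega) (fun z hz _ _ => ?_) PE (by omega) (by omega)
        (fun z hz _ _ => ⟨(hEbox z hz).1, (hEbox z hz).2.1⟩)
      obtain ⟨q, hq, rfl⟩ := physS z hz
      obtain ⟨-, -, -, -, -, -, g0, g1, -⟩ := rot_apply_formula q
      rw [Tube.mem_box] at hq; rw [g1]; constructor <;> omega
    · -- frame 4 (`ρ⁴ = -ρ`): the strip `x₀ ∈ [b, b+h]`, `x₀ + x₁ ∈ [-(a+w), -a]`; `E` horizontal
      obtain ⟨hEh, h1, h2, h3, h4⟩ := hJ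
      rw [hEh] at hE1
      obtain ⟨hxE, hyE⟩ : xE 0 = E.a ∧ yE 0 = E.a + E.w := hE1
      obtain ⟨-, -, -, -, -, -, -, -, fx0, fx1, -⟩ := rot_apply_formula x'
      obtain ⟨-, -, -, -, -, -, -, -, fy0, fy1, -⟩ := rot_apply_formula y'
      obtain ⟨z, hzE, hzS⟩ := exists_mem_of_cross (L := Sp.b) (R := Sp.b + Sp.h) (B := E.b) (T := E.b + E.h)
        (by omega) (by omega) PE (by omega) (by omega) (fun z hz _ _ => ⟨(hEbox z hz).2.2.1, (hEbox z hz).2.2.2⟩)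
        PS.symm (by rw [fy1]; omega) (by rw [fx1]; omega) (fun z hz _ _ => by
          obtain ⟨q, hq, rfl⟩ := physS z hz
          obtain ⟨-, -, -, -, -, -, -, -, g0, g1, -⟩ := rot_apply_formula q
          rw [Tube.mem_box] at hq; rw [g0]; constructor <;> omega)
      exact ⟨z, hzS, hzE⟩
    · -- frame 5 (`ρ⁵ = -ρ²`): the strip `x₁ ∈ [-(a+w), -a]`, `x₀ + x₁ ∈ [b, b+h]`; `E` horizontal
      obtain ⟨hEh, h1, h2, h3, h4⟩ := hJ
      rw [hEh] at hE1
      obtain ⟨hxE, hyE⟩ : xE 0 = E.a ∧ yE 0 = E.a + E.w := hE1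
      obtain ⟨-, -, -, -, -, -, -, -, -, -, fx0, fx1⟩ := rot_apply_formula x'
      obtain ⟨-, -, -, -, -, -, -, -, -, -, fy0, fy1⟩ := rot_apply_formula y'
      obtain ⟨z, hzE, hzS⟩ := exists_mem_of_cross (L := E.a) (R := E.a + E.w) (B := E.b) (T := E.b + E.h)
        (by omega) (by omega) PE (by omega) (by omega) (fun z hz _ _ => ⟨(hEbox z hz).2.2.1, (hEbox z hz).2.2.2⟩)
        PS.symm (by rw [fy1]; omega) (by rw [fx1]; omega) (fun z hz hzlo hzhi => by
          obtain ⟨q, hq, rfl⟩ := physS z hz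
          obtain ⟨-, -, -, -, -, -, -, -, -, -, g0, g1⟩ := rot_apply_formula q
          rw [Tube.mem_box] at hq; rw [g0]; rw [g1] at hzlo hzhi; constructor <;> omega)
      exact ⟨z, hzS, hzE⟩
  -- assemble
  obtain ⟨z, hzS, hzE⟩ := meet
  have Q3 : PathIn triGraph ((triRotIsoPow i '' Sp.box ∪ E.box) ∩ ω) z xE :=
    (TE z hzE).symm.mono fun v hv => ⟨Or.inr (hSE hv).1, (hSE hv).2⟩
  have Q2 : ∀ p ∈ S, PathIn triGraph ((triRotIsoPow i '' Sp.box ∪ E.box) ∩ ω) p z := fun p hp => by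
    refine (star p hp z hzS).mono fun v hv => ?_
    obtain ⟨q, hq, rfl⟩ := physS v hv
    exact ⟨Or.inl ⟨q, hq, rfl⟩, hSω hv⟩
  exact ⟨(Q2 _ PS.right_mem).trans Q3, (Q2 _ PS.left_mem).trans Q3⟩

end Literature.Probability.Percolation
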